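import Summits.QuantumFields.BalabanUV.T4Continuum.Support.VectorLineTransport
import Summits.QuantumFields.BalabanUV.T4Continuum.Support.VariationalColourInterpolant

/-!
# T⁴ programme, spine node NE2 (U1a), lane P2 — SUPPLIER LEAF V-ONE FOR E-VALUED 1-FORMS («V-ONE-1F»), file 1: THE TILTED FORWARD-TAYLOR
# INTERPOLANT OF A COARSE 1-FORM IN THE BLOCK FRAMES, THE FRAME-ADAPTED LINE TRANSPORTS, AND THE (1.18) LINE-AVERAGE CONSTRAINT HOLDING EXACTLY

NE2 formalisation swarm `b2b-balaban-t4-ne2-formalise-*`, leaf prover 01 GEN 6 (`prover-b2b-balaban-t4-ne2-formalise-leaf-01-g6-0`); successor of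
leaf-02-g4's INTENT «V-ONE-1F» (journal CLAIMS.log 2026-08-20 11:15Z, located note N-ne2leaf02g4-1) per the journal 2026-08-20 ≈13:00Z.  The socket is the
`hONE` binder of the road owner's `VariationalVectorForm.vector_pair_bracket_sqrt` (p216339): a one-step competitor for the LINE-averaged 1-form constraint.

THE LOCATED POINT (N-ne2leaf02g4-1, leaf-02-g4; design, about OUR competitor).  The (1.18) line-sum average of 1-forms is a TENT along the bond's own
direction (`VectorBlockTrialForm.sum_window`): the `L` lines started in block `y` read the fine `ν`-bond with `ν`-digit `s` of block `y` `s + 1` times and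
the one of block `y + e_ν` `L − 1 − s` times.  So the naive componentwise lift of the 0-form interpolant (`VariationalColourInterpolant.Phiv`, centred
weights `wt` in every direction, exact for the BLOCK average) misses the vector constraint by the zeroth-order spill `(L−1)∕(2L)·(D_νW)(y,ν)`.

THE REPAIR (this file; route (iii) of the note made EXACT).  Keep the centred weights `wt` in the TRANSVERSE directions and TILT the LONGITUDINAL one:
    `Φ(y, j, ν) := W(y,ν) + Σ_{μ≠ν} wt_L(j_μ) • (D_μW)(y,ν) + lt_L(j_ν) • (D_νW)(y,ν)`,   `lt_L(s) := ((L−1)(L−2) − 3(L−1)·s) ∕ (L(L+1))`,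
the unique affine profile with OWN MOMENT `Σ_{s<L}(s+1)·lt_L(s) = −L(L−1)∕2` (cancelling the zeroth-order spill) and ZERO SPILL MOMENT
`Σ_{s<L}(L−1−s)·lt_L(s) = 0` (the next block's derivative never enters); `|lt_L| ≤ 2`, and `Σ_s lt_L(s) = −(L−1)∕2 = L·wt_L(0)` — the number that makes
file 3's face sums a covariant derivative OF THE CURL (files 2–5: `VariationalVectorOneStep{Bonds,,End,Phys}`).  The interpolant is carried to the fine bonds by UNITARY site frames `U′`, `Λ′(x,ν) = U′(x)⋆Φ(·,ν)`, and
read by the FRAME-ADAPTED line transports `frameT U′ Rc`: `U′(p)` at own-block points `p` of the line, `Rc(y,ν) ∘ U′(p)` at its spill points (the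
product ∕ contour transports of [Balaban1985BackgroundPropagators] (3.13) SHAPE are these up to holonomy defects — a later file).  THEN (§3)
    **`QvL_interpV : QvL L N (frameT U′ Rc) (interpV U′ Rc W) = W`   EXACTLY**
(leaf-03-g4's line-indexed average `VectorLineTransport.QvL`, the window count `VectorBlockTrialForm.sum_window` and line points BY NAME).  LOCATED REMARK
(ours): for BOND-indexed transports (`QvT`) no block-local competitor meets the constraint exactly once `Rc ≠ 1` — the spill is read in the frame of block
`y + e_ν`, leaving `(L−1)∕(2L)·(1 − Rc(y,ν))W(y+e_ν,ν)`, which is `O(‖Rc − 1‖·‖W‖)` and not small; the line-indexed frame-adapted class is the exact one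
(consistent with the retired road owner's RULING that the tower's carriers are `QvL`).
CONTENT: §1 `lt` and its three moments, `|lt| ≤ 2`; §2 `PhiV` (= `Phiv` of the component + the longitudinal correction `(lt − wt)(j_ν)•(D_νW)(y,ν)`), the
transverse part `PsiV`, `PhiFV`, `interpV`, `frameT`, values along a line; §3 the per-fibre window sum `line_window_sumV`, the transverse cancellation, the END.

HONEST FRAMING (T4-DAG p. 1).  Model level: `E`-valued 1-forms on a finite torus, frames `U′` and coarse bond operators `Rc` DATA; [folklore] lattice
bookkeeping; nothing printed is a hypothesis (the one `[cite:]` is a SHAPE locator); data `def`s `lt`, `PhiV`, `PsiV`, `PhiFV`, `interpV`, `frameT` only, no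
`def … : Prop`, no `sorry`; axioms standard.  Nothing of leaf V-ONE's energy bound is here (files 2–5).  NE2 NOT proved; spine PROVED 0∕9; rung (B)+1 finite T⁴ —
NOT infinite volume, NOT mass gap, NOT Clay.  HONEST DEPENDENCY (cell, verbatim): continuum YM on T⁴ ⇐ BetaPertH ∧ nine spine estimates (0/9 proved);
BetaPertH ⇐ (D1) ∧ (D4) ∧ CAP+tail; G-an2-4 gates asym, D1 and NE2/3/4.
-/

noncomputable section

namespace Summit.QuantumFields.BalabanUV.T4Continuum.VariationalVectorInterpolant

open Finset
open Literature.MathematicalPhysics.QuantumFieldTheory.Balaban1983to89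
open Literature.MathematicalPhysics.QuantumFieldTheory.Balaban1983to89.B5Prop11Plancherel (Tor fine unitVec)
open Literature.MathematicalPhysics.QuantumFieldTheory.Balaban1983to89.B5Block118 (tstep bpt)
open Literature.MathematicalPhysics.QuantumFieldTheory.Balaban1983to89.B5Blocks16 (blockOf blockOf_bpt)
open Summit.QuantumFields.BalabanUV.T4Continuum.ScalarBlockTrialFunction (digits digits_bpt bpt_update')
open Summit.QuantumFields.BalabanUV.T4Continuum.VariationalCovariantWeights (wt sum_wt)
open Summit.QuantumFields.BalabanUV.T4Continuum.VariationalColourFederbush (cDv)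
open Summit.QuantumFields.BalabanUV.T4Continuum.VariationalColourInterpolant (Phiv sum_update_wt_sub)
open Summit.QuantumFields.BalabanUV.T4Continuum.VectorBlockTrialForm
  (QvL sums_closed sum_window tstep_add line_point_lt line_point_ge funSplitAt_symm_eq)

variable {d : ℕ} {E : Type*} [NormedAddCommGroup E] [InnerProductSpace ℂ E] [CompleteSpace E]

/-! ## §1 The longitudinal tilt `lt_L(s) = ((L−1)(L−2) − 3(L−1)s)∕(L(L+1))`: own moment `−L(L−1)∕2`, zero spill moment, sum `−(L−1)∕2`, `|lt| ≤ 2` -/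

/-- the LONGITUDINAL TILT of the 1-form interpolant: `lt_L(s) = ((L−1)(L−2) − 3(L−1)·s) ∕ (L(L+1))`. [folklore] -/
def lt (L : ℕ) (s : ℕ) : ℝ := (((L : ℝ) - 1) * ((L : ℝ) - 2) - 3 * ((L : ℝ) - 1) * s) / ((L : ℝ) * ((L : ℝ) + 1))

/-- **OWN MOMENT**: `Σ_{s<L} (s+1)·lt_L(s) = −L(L−1)∕2` — exactly minus the zeroth-order spill mass of the (1.18) tent. [folklore] -/
theorem sum_succ_mul_lt (L : ℕ) [NeZero L] : ∑ s ∈ range L, ((s : ℝ) + 1) * lt L s = -((L : ℝ) * ((L : ℝ) - 1) / 2) := by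
  have hL : (L : ℝ) ≠ 0 := by exact_mod_cast NeZero.ne L
  have hL1 : (L : ℝ) + 1 ≠ 0 := by positivity
  obtain ⟨h1, h2, -, -⟩ := sums_closed L
  have key : ∀ s : ℕ, ((s : ℝ) + 1) * lt L s
      = (((L : ℝ) - 1) * ((L : ℝ) - 2) / ((L : ℝ) * ((L : ℝ) + 1))) * ((s : ℝ) + 1)
        + (-(3 * ((L : ℝ) - 1)) / ((L : ℝ) * ((L : ℝ) + 1))) * ((s : ℝ) * ((s : ℝ) + 1)) := by
    intro s; unfold lt; field_simp; ring
  rw [sum_congr rfl fun s _ => key s, sum_add_distrib, ← mul_sum, ← mul_sum, h1, h2]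
  field_simp
  ring

/-- **SUM**: `Σ_{s<L} lt_L(s) = −(L−1)∕2`. [folklore] -/
theorem sum_lt (L : ℕ) [NeZero L] : ∑ s ∈ range L, lt L s = -(((L : ℝ) - 1) / 2) := by
  have hL : (L : ℝ) ≠ 0 := by exact_mod_cast NeZero.ne L
  have hL1 : (L : ℝ) + 1 ≠ 0 := by positivity
  obtain ⟨h1, -, -, -⟩ := sums_closed L
  have key : ∀ s : ℕ, lt L s = ((L : ℝ) - 1) / L + (-(3 * ((L : ℝ) - 1)) / ((L : ℝ) * ((L : ℝ) + 1))) * ((s : ℝ) + 1) := by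
    intro s; unfold lt; field_simp; ring
  rw [sum_congr rfl fun s _ => key s, sum_add_distrib, ← mul_sum, h1, sum_const, card_range, nsmul_eq_mul]
  field_simp
  ring

/-- **ZERO SPILL MOMENT**: `Σ_{s<L} (L−1−s)·lt_L(s) = 0` — the next block's longitudinal derivative never enters the line average. [folklore] -/
theorem sum_rev_mul_lt (L : ℕ) [NeZero L] : ∑ s ∈ range L, ((L : ℝ) - 1 - s) * lt L s = 0 := by
  have key : ∀ s : ℕ, ((L : ℝ) - 1 - s) * lt L s = (L : ℝ) * lt L s - ((s : ℝ) + 1) * lt L s := fun s => by ring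
  rw [sum_congr rfl fun s _ => key s, sum_sub_distrib, ← mul_sum, sum_lt, sum_succ_mul_lt]
  ring

/-- the sum over `Fin L`: `Σ_i lt_L(i) = −(L−1)∕2 = L·wt_L(0)`. [folklore] -/
theorem sum_lt_fin (L : ℕ) [NeZero L] : ∑ i : Fin L, lt L i = -(((L : ℝ) - 1) / 2) ∧ ∑ i : Fin L, lt L i = (L : ℝ) * wt L 0 := by
  have h : ∑ i : Fin L, lt L i = -(((L : ℝ) - 1) / 2) := by rw [← sum_lt L, ← Finset.sum_range (fun s => lt L s)]
  refine ⟨h, ?_⟩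
  have hL : (L : ℝ) ≠ 0 := by exact_mod_cast NeZero.ne L
  rw [h]; unfold wt; push_cast; field_simp; ring

/-- `|lt_L(s)| ≤ 2` for `s < L`. [folklore] -/
theorem abs_lt_le (L : ℕ) {s : ℕ} (hs : s < L) : |lt L s| ≤ 2 := by
  have hL : (0 : ℝ) < L := by exact_mod_cast Nat.zero_lt_of_lt hs
  have hs' : (s : ℝ) + 1 ≤ L := by exact_mod_cast hs
  have hs0 : (0 : ℝ) ≤ s := Nat.cast_nonneg s
  unfold lt
  rw [abs_div, abs_of_pos (by positivity : (0 : ℝ) < (L : ℝ) * ((L : ℝ) + 1)), div_le_iff₀ (by positivity), abs_le]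
  constructor <;> nlinarith [mul_nonneg hL.le hs0]

/-- `|lt_L(s) − wt_L(s)| ≤ 5∕2` for `s < L`. [folklore] -/
theorem abs_lt_sub_wt_le (L : ℕ) {s : ℕ} (hs : s < L) : |lt L s - wt L s| ≤ 5 / 2 := by
  have h1 := abs_lt_le L hs
  have h2 := VariationalCovariantWeights.abs_wt_le L hs
  calc |lt L s - wt L s| ≤ |lt L s| + |wt L s| := abs_sub _ _
    _ ≤ 2 + 1 / 2 := add_le_add h1 h2
    _ = 5 / 2 := by norm_num

/-! ## §2 The interpolant, its transverse part, the competitor, the frame-adapted line transports -/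

section Objects

variable (L : ℕ) [NeZero L] (N : Fin d → ℕ) [∀ μ, NeZero (N μ)]

/-- **THE TILTED INTERPOLANT OF A 1-FORM IN THE BLOCK FRAME** `y`, offset `j`, component `ν`: the 0-form interpolant of the component `W(·,ν)` (centred
weights in every direction) PLUS the longitudinal correction `(lt_L − wt_L)(j_ν) • (D_νW)(y,ν)` — i.e. `W(y,ν) + Σ_{μ≠ν} wt_L(j_μ)•(D_μW)(y,ν) + lt_L(j_ν)•(D_νW)(y,ν)`. [folklore] -/
def PhiV (Rc : Tor N → Fin d → (E →L[ℂ] E)) (W : Tor N → Fin d → E) (y : Tor N) (j : Fin d → Fin L) (ν : Fin d) : E :=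
  Phiv L N Rc (fun z => W z ν) y j + (((lt L (j ν) - wt L (j ν)) : ℝ) : ℂ) • cDv N Rc (fun z => W z ν) y ν

/-- the TRANSVERSE part: `Ψ(y, j, ν) = Σ_{μ≠ν} wt_L(j_μ) • (D_μW)(y,ν)` (independent of the longitudinal digit `j_ν`). [folklore] -/
def PsiV (Rc : Tor N → Fin d → (E →L[ℂ] E)) (W : Tor N → Fin d → E) (y : Tor N) (j : Fin d → Fin L) (ν : Fin d) : E :=
  ∑ μ ∈ univ.erase ν, ((wt L (j μ) : ℝ) : ℂ) • cDv N Rc (fun z => W z ν) y μ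

/-- the interpolant as a fine 1-form in the block frames. [folklore] -/
def PhiFV (Rc : Tor N → Fin d → (E →L[ℂ] E)) (W : Tor N → Fin d → E) : Tor (fine L N) → Fin d → E :=
  fun x ν => PhiV L N Rc W (blockOf L N x) (digits L N x) ν

/-- **THE COMPETITOR**: `Λ′(x,ν) = U′(x)⋆ Φ(block x, digits x, ν)` — carried to the fine sites by the adjoint site frames (one frame per site for all
components, as for [Balaban1985BackgroundPropagators] (3.13)'s contour transport to the bond's base point; the 0-form pattern of `interpv`). [folklore] -/
def interpV (U' : Tor (fine L N) → (E →L[ℂ] E)) (Rc : Tor N → Fin d → (E →L[ℂ] E)) (W : Tor N → Fin d → E) :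
    Tor (fine L N) → Fin d → E :=
  fun x ν => star (U' x) (PhiFV L N Rc W x ν)

/-- **THE FRAME-ADAPTED LINE TRANSPORTS**: the line started at `L·y + j` reads its `t`-th `ν`-bond `p = L·y + j + t e_ν` through the frame `U′(p)` while
`p` is in block `y` (`j_ν + t < L`) and through `Rc(y,ν) ∘ U′(p)` once it has spilled into block `y + e_ν`
([Balaban1985BackgroundPropagators] (3.13) SHAPE «parallel transport from the block to the bond», frames DATA). [cite: Balaban1985BackgroundPropagators, (3.13) p.392] -/
def frameT (U' : Tor (fine L N) → (E →L[ℂ] E)) (Rc : Tor N → Fin d → (E →L[ℂ] E)) :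
    Tor N → (Fin d → Fin L) → Fin L → Fin d → (E →L[ℂ] E) :=
  fun y j t ν => if (j ν : ℕ) + (t : ℕ) < L then U' (bpt L N y j + tstep (fine L N) ν t)
    else Rc y ν * U' (bpt L N y j + tstep (fine L N) ν t)

variable (Rc : Tor N → Fin d → (E →L[ℂ] E)) (W : Tor N → Fin d → E)

omit [CompleteSpace E] in
/-- `Φ` read at a block point. [folklore] -/
theorem PhiFV_bpt (y : Tor N) (j : Fin d → Fin L) (ν : Fin d) : PhiFV L N Rc W (bpt L N y j) ν = PhiV L N Rc W y j ν := by
  rw [PhiFV, blockOf_bpt, digits_bpt]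

/-- `Λ′` read at a block point. [folklore] -/
theorem interpV_bpt (U' : Tor (fine L N) → (E →L[ℂ] E)) (y : Tor N) (j : Fin d → Fin L) (ν : Fin d) :
    interpV L N U' Rc W (bpt L N y j) ν = star (U' (bpt L N y j)) (PhiV L N Rc W y j ν) := by
  rw [interpV, PhiFV_bpt]

omit [NeZero L] [∀ μ, NeZero (N μ)] [CompleteSpace E] in
/-- **THE SPLIT FORM**: `Φ(y,j,ν) = W(y,ν) + lt_L(j_ν)•(D_νW)(y,ν) + Ψ(y,j,ν)`. [folklore] -/
theorem PhiV_eq (y : Tor N) (j : Fin d → Fin L) (ν : Fin d) :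
    PhiV L N Rc W y j ν = W y ν + ((lt L (j ν) : ℝ) : ℂ) • cDv N Rc (fun z => W z ν) y ν + PsiV L N Rc W y j ν := by
  unfold PhiV Phiv PsiV
  rw [← Finset.add_sum_erase univ _ (mem_univ ν)]
  have e : (((lt L (j ν) - wt L (j ν)) : ℝ) : ℂ) = ((lt L (j ν) : ℝ) : ℂ) - ((wt L (j ν) : ℝ) : ℂ) := by push_cast; rfl
  rw [e, sub_smul]
  abel

omit [NeZero L] [∀ μ, NeZero (N μ)] [CompleteSpace E] in
/-- the transverse part does not see the longitudinal digit. [folklore] -/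
theorem PsiV_update (y : Tor N) (j : Fin d → Fin L) (ν : Fin d) (a : Fin L) :
    PsiV L N Rc W y (Function.update j ν a) ν = PsiV L N Rc W y j ν := by
  unfold PsiV
  refine Finset.sum_congr rfl fun μ hμ => ?_
  rw [Function.update_of_ne (ne_of_mem_erase hμ)]

omit [NeZero L] [∀ μ, NeZero (N μ)] [CompleteSpace E] in
/-- **VALUE ALONG A LINE**: `Φ(y, j[ν ↦ a], ν) = W(y,ν) + lt_L(a)•(D_νW)(y,ν) + Ψ(y, j, ν)`. [folklore] -/
theorem PhiV_update (y : Tor N) (j : Fin d → Fin L) (ν : Fin d) (a : Fin L) :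
    PhiV L N Rc W y (Function.update j ν a) ν = W y ν + ((lt L a : ℝ) : ℂ) • cDv N Rc (fun z => W z ν) y ν + PsiV L N Rc W y j ν := by
  rw [PhiV_eq, PsiV_update, Function.update_self]

/-- the frame-adapted line transports undo the frames: at an own-block point the line reads `Φ`, at a spill point `Rc(y,ν) Φ`. [folklore] -/
theorem frameT_interpV {U' : Tor (fine L N) → (E →L[ℂ] E)} (hU : ∀ x, U' x ∈ unitary (E →L[ℂ] E))
    (y : Tor N) (j : Fin d → Fin L) (t : Fin L) (ν : Fin d) :
    frameT L N U' Rc y j t ν (interpV L N U' Rc W (bpt L N y j + tstep (fine L N) ν t) ν)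
      = if (j ν : ℕ) + (t : ℕ) < L then PhiFV L N Rc W (bpt L N y j + tstep (fine L N) ν t) ν
        else Rc y ν (PhiFV L N Rc W (bpt L N y j + tstep (fine L N) ν t) ν) := by
  have hUU : ∀ (x : Tor (fine L N)) (v : E), U' x (star (U' x) v) = v := fun x v => by
    have h := congrArg (fun S : E →L[ℂ] E => S v) (Unitary.mem_iff.mp (hU x)).2
    simpa only [mul_apply_eq_comp, one_apply_eq_self] using h
  unfold frameT interpV
  split_ifs with h
  · rw [hUU]
  · rw [mul_apply_eq_comp, hUU]

end Objects

/-! ## §3 THE EXACT CONSTRAINT `Q_{frameT} Λ′ = W` -/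

section Constraint

variable (L : ℕ) [NeZero L] (N : Fin d → ℕ) [∀ μ, NeZero (N μ)] (Rc : Tor N → Fin d → (E →L[ℂ] E)) (W : Tor N → Fin d → E)

omit [NeZero L] [CompleteSpace E] in
/-- a transverse weight summed over the transverse digits vanishes: `Σ_q wt_L(q_κ) = 0`. [folklore] -/
theorem sum_wt_transverse (ν : Fin d) (κ : {μ // μ ≠ ν}) : ∑ q : {μ // μ ≠ ν} → Fin L, wt L (q κ) = 0 := by
  rw [← (Equiv.funSplitAt κ (Fin L)).symm.sum_comp, Fintype.sum_prod_type]
  have h : ∀ (i : Fin L) (r : {j : {μ // μ ≠ ν} // j ≠ κ} → Fin L), wt L (((Equiv.funSplitAt κ (Fin L)).symm (i, r)) κ) = wt L i := by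
    intro i r; simp
  simp_rw [h]
  rw [Finset.sum_comm]
  simp only [sum_wt, Finset.sum_const_zero]

/-- **THE WINDOW SUM OF ONE TRANSVERSE FIBRE**: for fixed transverse digits `q`, the `L` lines started at `ν`-digits `i < L` deposit
`L² • W(y,ν)` plus a combination of the transverse weights `wt_L(q_μ)` with `q`-INDEPENDENT vectors — the own moment of `lt` cancels the zeroth-order spill and
its zero spill moment removes the next block's longitudinal derivative. [folklore] -/
theorem line_window_sumV {U' : Tor (fine L N) → (E →L[ℂ] E)} (hU : ∀ x, U' x ∈ unitary (E →L[ℂ] E))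
    (y : Tor N) (ν : Fin d) (q : {μ // μ ≠ ν} → Fin L) :
    ∑ i : Fin L, ∑ t : Fin L, frameT L N U' Rc y ((Equiv.funSplitAt ν (Fin L)).symm (i, q)) t ν
        (interpV L N U' Rc W (bpt L N y ((Equiv.funSplitAt ν (Fin L)).symm (i, q)) + tstep (fine L N) ν t) ν)
      = (((L : ℝ) ^ 2 : ℝ) : ℂ) • W y ν
        + ∑ μ ∈ univ.erase ν, ((wt L (((Equiv.funSplitAt ν (Fin L)).symm (0, q)) μ) : ℝ) : ℂ) •
            ((((L : ℝ) * ((L : ℝ) + 1) / 2 : ℝ) : ℂ) • cDv N Rc (fun z => W z ν) y μ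
              + (((L : ℝ) * ((L : ℝ) - 1) / 2 : ℝ) : ℂ) • Rc y ν (cDv N Rc (fun z => W z ν) (y + unitVec N ν) μ)) := by
  have hL : 0 < L := Nat.pos_of_ne_zero (NeZero.ne L)
  set j₀ : Fin d → Fin L := (Equiv.funSplitAt ν (Fin L)).symm (0, q) with hj₀
  have hj : j₀ ν = 0 := (funSplitAt_symm_eq L ν 0 q).2
  -- abbreviations
  set D : E := cDv N Rc (fun z => W z ν) y ν with hD
  set D' : E := cDv N Rc (fun z => W z ν) (y + unitVec N ν) ν with hD'
  set P₀ : E := W y ν + PsiV L N Rc W y j₀ ν with hP₀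
  set P₁ : E := W (y + unitVec N ν) ν + PsiV L N Rc W (y + unitVec N ν) j₀ ν with hP₁
  -- the line values as a function of the parameter
  set h : ℕ → E := fun s => if hs : s < L then P₀ + ((lt L s : ℝ) : ℂ) • D
    else if hs' : s - L < L then Rc y ν (P₁ + ((lt L (s - L) : ℝ) : ℂ) • D') else 0 with hh
  -- Step 1: the double sum is a window sum of `h`
  have step1 : ∑ i : Fin L, ∑ t : Fin L, frameT L N U' Rc y ((Equiv.funSplitAt ν (Fin L)).symm (i, q)) t ν
        (interpV L N U' Rc W (bpt L N y ((Equiv.funSplitAt ν (Fin L)).symm (i, q)) + tstep (fine L N) ν t) ν)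
      = ∑ i ∈ range L, ∑ t ∈ range L, h (i + t) := by
    rw [Finset.sum_range (fun i => ∑ t ∈ range L, h (i + t))]
    refine Fintype.sum_congr _ _ fun i => ?_
    rw [Finset.sum_range (fun t => h (i + t))]
    refine Fintype.sum_congr _ _ fun t => ?_
    rw [(funSplitAt_symm_eq L ν i q).1, ← hj₀, frameT_interpV L N Rc W hU]
    have hpt : bpt L N y (Function.update j₀ ν i) + tstep (fine L N) ν t = bpt L N y j₀ + tstep (fine L N) ν ((i : ℕ) + t) := by
      rw [bpt_update' L N y j₀ ν i, tstep_add, ← add_assoc]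
      have h0 : Function.update j₀ ν (0 : Fin L) = j₀ := by rw [← hj, Function.update_eq_self]
      rw [h0]
    simp only [Function.update_self, hpt]
    by_cases hit : (i : ℕ) + (t : ℕ) < L
    · rw [if_pos hit, line_point_lt L N y hj _ hit, PhiFV_bpt, PhiV_update, hh]
      simp only [dif_pos hit]
      rw [hP₀]; abel
    · have hs : (i : ℕ) + t - L < L := by have := i.is_lt; have := t.is_lt; omega
      have e : (i : ℕ) + (t : ℕ) = L + ((i : ℕ) + t - L) := by omega
      rw [if_neg hit, e, line_point_ge L N y hj _ hs, PhiFV_bpt, PhiV_update, hh]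
      simp only
      rw [dif_neg (by omega), Nat.add_sub_cancel_left, dif_pos hs, hP₁]
      congr 1; abel
  -- Step 2: the two windows
  have hw1 : ∀ s ∈ range L, (s + 1) • h s = (((s : ℝ) + 1 : ℝ) : ℂ) • P₀ + ((((s : ℝ) + 1) * lt L s : ℝ) : ℂ) • D := by
    intro s hs
    rw [mem_range] at hs
    rw [hh]; simp only [dif_pos hs]
    rw [← Nat.cast_smul_eq_nsmul ℂ, smul_add, smul_smul]
    push_cast; rfl
  have hw2 : ∀ s ∈ range L, (L - 1 - s) • h (L + s)
      = ((((L : ℝ) - 1 - s) : ℝ) : ℂ) • Rc y ν P₁ + (((((L : ℝ) - 1 - s) * lt L s) : ℝ) : ℂ) • Rc y ν D' := by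
    intro s hs
    rw [mem_range] at hs
    have hc : ((L - 1 - s : ℕ) : ℂ) = ((((L : ℝ) - 1 - s) : ℝ) : ℂ) := by
      have e : (L - 1 - s) + s + 1 = L := by omega
      have e' : ((L - 1 - s : ℕ) : ℂ) + s + 1 = L := by exact_mod_cast e
      push_cast
      linear_combination e'
    rw [hh]; simp only
    rw [dif_neg (by omega), Nat.add_sub_cancel_left, dif_pos hs, ← Nat.cast_smul_eq_nsmul ℂ, hc, map_add, map_smul, smul_add,
      smul_smul]
    push_cast; rfl
  obtain ⟨hA1, -, -, -⟩ := sums_closed L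
  have hB1 : ∑ s ∈ range L, (((L : ℝ) - 1 - s) : ℝ) = (L : ℝ) * ((L : ℝ) - 1) / 2 := by
    have key : ∀ s : ℕ, (((L : ℝ) - 1 - s) : ℝ) = (L : ℝ) - ((s : ℝ) + 1) := fun s => by ring
    rw [sum_congr rfl fun s _ => key s, sum_sub_distrib, hA1, sum_const, card_range, nsmul_eq_mul]; ring
  rw [step1, sum_window, sum_congr rfl hw1, sum_congr rfl hw2, sum_add_distrib, sum_add_distrib, ← Finset.sum_smul, ← Finset.sum_smul,
    ← Finset.sum_smul, ← Finset.sum_smul, ← Complex.ofReal_sum, ← Complex.ofReal_sum, ← Complex.ofReal_sum, ← Complex.ofReal_sum,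
    hA1, sum_succ_mul_lt, hB1, sum_rev_mul_lt]
  -- Step 3: algebra — `Rc P₁ = D + W y ν + Rc Ψ(y+e_ν)` and the coefficient of `D` vanishes
  have hRcP₁ : Rc y ν P₁ = D + W y ν + Rc y ν (PsiV L N Rc W (y + unitVec N ν) j₀ ν) := by
    rw [hP₁, map_add, hD]; unfold cDv; abel
  have hΨ : ∀ (z : Tor N) (c : ℂ), c • PsiV L N Rc W z j₀ ν = ∑ μ ∈ univ.erase ν, ((wt L (j₀ μ) : ℝ) : ℂ) • (c • cDv N Rc (fun z => W z ν) z μ) := by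
    intro z c; unfold PsiV; rw [Finset.smul_sum]; refine sum_congr rfl fun μ _ => ?_; rw [smul_comm]
  have hRcΨ : ∀ c : ℂ, c • Rc y ν (PsiV L N Rc W (y + unitVec N ν) j₀ ν)
      = ∑ μ ∈ univ.erase ν, ((wt L (j₀ μ) : ℝ) : ℂ) • (c • Rc y ν (cDv N Rc (fun z => W z ν) (y + unitVec N ν) μ)) := by
    intro c; unfold PsiV; rw [map_sum, Finset.smul_sum]; refine sum_congr rfl fun μ _ => ?_; rw [map_smul, smul_comm]
  have hsum : ∑ μ ∈ univ.erase ν, ((wt L (j₀ μ) : ℝ) : ℂ) •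
      ((((L : ℝ) * ((L : ℝ) + 1) / 2 : ℝ) : ℂ) • cDv N Rc (fun z => W z ν) y μ
        + (((L : ℝ) * ((L : ℝ) - 1) / 2 : ℝ) : ℂ) • Rc y ν (cDv N Rc (fun z => W z ν) (y + unitVec N ν) μ))
      = (((L : ℝ) * ((L : ℝ) + 1) / 2 : ℝ) : ℂ) • PsiV L N Rc W y j₀ ν
        + (((L : ℝ) * ((L : ℝ) - 1) / 2 : ℝ) : ℂ) • Rc y ν (PsiV L N Rc W (y + unitVec N ν) j₀ ν) := by
    rw [hΨ, hRcΨ, ← sum_add_distrib]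
    simp only [smul_add]
  rw [hRcP₁, hP₀, Complex.ofReal_zero, zero_smul, add_zero, hsum]
  push_cast
  module

/-- **THE CONSTRAINT, EXACTLY**: `QvL L N (frameT U′ Rc) (interpV U′ Rc W) = W` for unitary fine site frames — the (1.18) line-sum average of the tilted
interpolant, read through the frame-adapted line transports, returns the coarse 1-form on the nose. [folklore] -/
theorem QvL_interpV {U' : Tor (fine L N) → (E →L[ℂ] E)} (hU : ∀ x, U' x ∈ unitary (E →L[ℂ] E)) :
    QvL L N (frameT L N U' Rc) (interpV L N U' Rc W) = W := by
  funext y ν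
  have hL : ((L : ℂ) ^ (d + 1)) ≠ 0 := pow_ne_zero _ (by exact_mod_cast NeZero.ne L)
  unfold QvL
  rw [← (Equiv.funSplitAt ν (Fin L)).symm.sum_comp, Fintype.sum_prod_type, Finset.sum_comm]
  simp_rw [line_window_sumV L N Rc W hU y ν]
  rw [sum_add_distrib, sum_const, card_univ, Finset.sum_comm]
  -- the transverse weights cancel fibre by fibre of the weight index
  have h0 : ∀ μ ∈ univ.erase ν, ∑ q : {κ // κ ≠ ν} → Fin L, ((wt L (((Equiv.funSplitAt ν (Fin L)).symm (0, q)) μ) : ℝ) : ℂ) •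
      ((((L : ℝ) * ((L : ℝ) + 1) / 2 : ℝ) : ℂ) • cDv N Rc (fun z => W z ν) y μ
        + (((L : ℝ) * ((L : ℝ) - 1) / 2 : ℝ) : ℂ) • Rc y ν (cDv N Rc (fun z => W z ν) (y + unitVec N ν) μ)) = 0 := by
    intro μ hμ
    have hne : μ ≠ ν := ne_of_mem_erase hμ
    rw [← Finset.sum_smul, ← Complex.ofReal_sum]
    have hq : ∀ q : {κ // κ ≠ ν} → Fin L, ((Equiv.funSplitAt ν (Fin L)).symm (0, q)) μ = q ⟨μ, hne⟩ := fun q => by simp [hne]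
    simp_rw [hq]
    rw [sum_wt_transverse L ν ⟨μ, hne⟩, Complex.ofReal_zero, zero_smul]
  rw [sum_congr rfl h0, sum_const_zero, add_zero]
  have hcard : (Fintype.card ({κ // κ ≠ ν} → Fin L) : ℂ) = (L : ℂ) ^ (d - 1) := by
    rw [Fintype.card_fun, Fintype.card_fin, Fintype.card_subtype_compl, Fintype.card_fin, Fintype.card_subtype_eq]; push_cast; ring
  rw [← Nat.cast_smul_eq_nsmul ℂ, smul_smul, smul_smul, hcard]
  have hd : 1 ≤ d := Nat.succ_le_of_lt (Fin.pos ν)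
  obtain ⟨d', rfl⟩ : ∃ d', d = d' + 1 := ⟨d - 1, by omega⟩
  rw [Nat.add_sub_cancel]
  have e : ((L : ℂ) ^ (d' + 1 + 1))⁻¹ * (L : ℂ) ^ d' * (((L : ℝ) ^ 2 : ℝ) : ℂ) = 1 := by
    push_cast
    rw [mul_assoc, show (L : ℂ) ^ d' * (L : ℂ) ^ 2 = (L : ℂ) ^ (d' + 1 + 1) by ring]
    exact inv_mul_cancel₀ hL
  rw [e, one_smul]

end Constraint

end Summit.QuantumFields.BalabanUV.T4Continuum.VariationalVectorInterpolant

end
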